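import Literature.MathematicalPhysics.QuantumManyBody.BoseEinsteinCondensation
import Literature.MathematicalPhysics.QuantumManyBody.LiebYngvasonCellMethod
import Literature.Probability.Process.BrownianMotion
import Literature.Probability.RandomPlanarGeometry.LocalMartingaleProofs
import Mathlib.MeasureTheory.Measure.WithDensity
import Mathlib.MeasureTheory.Constructions.Pi
import Mathlib.Analysis.SpecialFunctions.Exp
import HarnessLib

/-!
# Ground-state Feynman–Kac representation of the Dirichlet `N`-particle problem in a box

Topic `Literature/MathematicalPhysics/QuantumManyBody` (definition item
`defn-GroundStateFeynmanKac`; wanted by route `BECPalmLandscape`, crux `DebyeScreenedLandscape`,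
and by route `BECWeakDisorder`). Everything is built over
`Literature.MathematicalPhysics.QuantumManyBody.BoseGas.{Space, Config, box, boxN, interaction,
TrialState, energy, groundStateEnergy}` (`BoseEinsteinCondensation.lean`) and the
tree's canonical Brownian motion `Literature.Probability.Process.{preWienerMeasure, brownian}`
(`Probability/Process/BrownianMotion.lean`; a probability measure and a Brownian motion
unconditionally, `RandomPlanarGeometry/LocalMartingaleProofs.lean`).

## Content

The `T = 0` (ground-state) Feynman–Kac machinery for
`H_N = -∑ᵢ Δᵢ + ∑_{i<j} v(|xᵢ - xⱼ|)` on the box `Λ_L^N = ((0,L)³)^N` with Dirichlet boundary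
conditions and a repulsive radial pair potential `v : ℝ → [0, ∞]` (hard cores `v = ⊤` allowed),
for DISTINGUISHABLE particles (no permutations: the bosonic ground state is the absolute ground
state: Reed–Simon IV §XIII.12, remark after the Corollary to Thm XIII.46, "ground states of
Boson systems are nondegenerate").

* `PathSpace N`, `wienerPaths N` — `3N` independent canonical Wiener coordinates; `worldLine X ω s`
  — the `N` world-lines `Bⁱ_s = Xᵢ + √2 bⁱ_s ∈ ℝ³` started at `X` (generator `Δ` per particle,
  matching `H_N`; i.e. standard Brownian motion run at speed `2`).
* `pathAction v T X ω = ∫₀ᵀ ∑_{i<j} v(|Bⁱ_s - Bʲ_s|) ds ∈ [0, ∞]` (lower Lebesgue integral in time),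
  `expNeg a = e^{-a}` on `[0, ∞]` with `e^{-∞} = 0`, `survives L T X` — the event that all
  world-lines stay in the open box on `[0, T]` (Dirichlet killing; time `0` included, so nothing
  survives from `X ∉ Λ_L^N`), and the Feynman–Kac weight
  `fkWeight = 𝟙_{survives} · e^{-pathAction} ∈ [0, 1]`.
* `fkPathMeasure v L T X` — the **killed, interaction-weighted path measure**
  `𝟙{τ_{Λ^N} > T} exp(-∫₀ᵀ ∑_{i<j} v) dW_X` (a finite sub-probability measure on `PathSpace N`),
  and `fkSemigroup v L T g X = E_X[exp(-∫₀ᵀ ∑ v(|Bⁱ_s-Bʲ_s|)ds) g(B_T); τ > T]`, the Feynman–Kac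
  functional, i.e. the Dirichlet Schrödinger semigroup `(e^{-T H_N} g)(X)` evaluated path-wise
  (Chung–Zhao (3.34), Thm 3.17, Thm 3.27; by Brownian scaling `E_X[F((X + √2 b_s)_s)] =
  E_X[F((b_{2s})_s)]`, so this is Chung–Zhao's `T_{2T}` for `q = -V/2`, whose generator is
  `2(Δ/2 - V/2) = -H_N`). `fkPartition v L T X = fkSemigroup v L T 1 X` is the partition function
  of the `N` killed, weighted world-lines on `[0, T]`.
* `IsGroundStateFK v L Ψ₀` (`N` implicit) — HYPOTHESIS STRUCTURE "`Ψ₀` is the (unique,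
  nonnegative, normalised, Bose-symmetric) Dirichlet ground state of `H_N` on `Λ_L^N`, reached by
  Feynman–Kac": the
  eigen-relation `e^{-T H_N} Ψ₀ = e^{-E₀ T} Ψ₀` pointwise with `E₀ = groundStateEnergy v N L`
  (the variational infimum over the symmetric `C¹` Dirichlet core `TrialState N L`), and the
  ground-state projection limit `e^{E₀ T} (e^{-T H_N} g)(X) → ⟨Ψ₀, g⟩ Ψ₀(X)` as `T → ∞` for every
  `g ∈ L²₊` and every `X` — "Ψ₀ is the Feynman–Kac limit"; with `g = 1`:
  `Ψ₀(x, Y) ∝ lim_T e^{E₀T} · fkPartition v L T (x, Y)`, the partition function of the future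
  half-lines given the slice `(x, Y)` (the form used by the landscape / cut-world-line pictures).
  Proved here: any two witnesses coincide (`IsGroundStateFK.unique`), so the structure pins down
  one function.
* `GroundStateFeynmanKac` — the NAMED FACT (Perron–Frobenius–Feynman–Kac package for bounded
  pair potentials): for `N ≥ 1`, `L > 0` and `v` measurable and bounded, a witness of
  `IsGroundStateFK v L` exists, is continuous and is strictly positive on the open box.
* `fkGroundState v N L` — the witness as a term (classical choice; junk `0` if none), with
  `IsGroundStateFK.eq_fkGroundState`.
* Proved API: sub-Markov bounds, killing from outside the box, `T = 0`, the functional only sees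
  `g` on the box; measurability of the survival event (countable description through rational
  times, `survives_eq_iUnion_iInter`, by path continuity and openness of the box), of the action
  (Tonelli) and of the weight, whence `∫ f d(fkPathMeasure) = ∫ fkWeight · f dW` for every `f`
  (`lintegral_fkPathMeasure`) and `fkSemigroup = ∫ g(B_T) d(fkPathMeasure)`.

## Sources and the derivation behind `GroundStateFeynmanKac`

For bounded measurable `v` the potential `V = ∑_{i<j} v(|xᵢ-xⱼ|)` is bounded measurable on the
bounded, connected, regular domain `D = Λ_L^N ⊂ ℝ^{3N}`. Chung–Zhao [ChungZhao1995]: the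
Feynman–Kac semigroup `T_t f(x) = Eˣ{t < τ_D; e_q(t) f(X_t)}` ((3.34), `q ∈ J ⊇ L^∞`) is a strongly
continuous self-adjoint semigroup on `L²(D)`, bounded `L² → L^∞`, strong Feller, with a continuous
symmetric strictly positive kernel (Thm 3.17 with Thm 2.4: `p^D(t;x,y) > 0` on `D × D`, and
`u_t ≥ e^{-t‖V‖_∞} p^D`), compact with the same eigenfunctions in `L²` and `C₀(D)` (Thm 3.17,
`m(D) < ∞`, `D` regular), generator `Δ/2 + q` on `W₀^{1,2}(D)` (Thm 3.27) and top of the spectrum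
`λ₁ = sup {∫_D (-|∇φ|²/2 + qφ²) : φ ∈ C_c^∞(D), ‖φ‖₂ = 1}` (Prop 3.29). Positivity improving +
eigenvalue at the bottom ⇒ simple eigenvalue with strictly positive eigenfunction (Reed–Simon IV
Thm XIII.44 [ReedSimonIV1978]; Glimm–Jaffe Thms 3.3.2–3.3.3 [GlimmJaffeQP1987]; Davies Prop 1.4.3
and Thm 3.3.5 [Davies1989]); uniqueness ⇒ the ground state is permutation symmetric, so the
infimum over symmetric `C_c^∞ ⊂ TrialState ⊂ H¹₀` states equals `inf σ(H_N)` (Reed–Simon IV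
§XIII.12, remark after Thm XIII.46; `groundStateEnergy` is that infimum, [LSSY2005] (2.3));
spectral theorem + gap ⇒
`e^{tE₀} e^{-tH} g → ⟨Ψ₀, g⟩ Ψ₀` in `L²` (Glimm–Jaffe (3.4.2)), upgraded to every point by one more
application of `T_1 : L² → L^∞` (Chung–Zhao Thm 3.17); continuity and pointwise eigen-relation:
eigenfunctions lie in `C₀(D)` (Thm 3.17). For the free/mean-field gas the same large-time
eigenfunction expansion of the killed Brownian transition density drives the Feynman–Kac proof of
ODLRO in [KonigVogelZass2025] (§1.3, §2 and the proof of Lemma `FKrepgamma` in §5); the path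
picture of the Bose ground state is Ceperley's [Ceperley1995].

## Design choices / what is NOT here

* HARD CORES. All definitions and the structure `IsGroundStateFK` make sense for `v` with values
  `⊤` (infinite action ⇒ weight `0`, a.s. killing on contact). The named fact is stated ONLY for
  bounded `v`: with hard cores the accessible region `{V < ∞} ⊂ Λ_L^N` may be disconnected and the
  Dirichlet ground state degenerate (Reed–Simon IV Thm XIII.48(b)); its nondegeneracy at low
  density is a crux of the requesting routes (`GroundStateRigidity`), not literature, and is
  deliberately not asserted.
* No operators / semigroups as objects: `e^{-TH}` enters only through the path integral
  `fkSemigroup`; the link to the variational world of `BoseEinsteinCondensation.lean` is the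
  number `groundStateEnergy v N L` in the eigen-relation.
* Time is a real parameter `T` (paths are indexed by `ℝ≥0`, read through `Real.toNNReal`, as in
  `Probability/Process/BrownianVec.lean`); `[0, ∞]`-valued integrands throughout, so no
  integrability side conditions and no junk from `⊤`.
* Not here: Brownian bridges / closed loops and permutation cycles (positive temperature), the
  Feynman–Kac formula as an operator identity, Kato-class potentials.
-/

noncomputable section

open MeasureTheory Filter Metric
open scoped ENNReal NNReal Topology

namespace Literature.MathematicalPhysics.QuantumManyBody.BoseGas

open Literature.Probability.Process (preWienerMeasure brownian brownian_zero measurable_brownian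
  continuous_brownian)

/-! ### World-lines -/

/-- Sample space of `N` three-dimensional world-lines: `3N` canonical Wiener coordinates
`ω i k : ℝ≥0 → ℝ` (particle `i`, Cartesian component `k`). [folklore] -/
abbrev PathSpace (N : ℕ) : Type := Fin N → Fin 3 → (ℝ≥0 → ℝ)

/-- The law of `3N` independent standard Brownian coordinates: the product of `3N` copies of the
pre-Wiener measure (Kallenberg, *Foundations* (2002), Thm 13.5 and Lemma 3.10). [folklore] -/
def wienerPaths (N : ℕ) : Measure (PathSpace N) :=
  Measure.pi fun _ : Fin N => Measure.pi fun _ : Fin 3 => preWienerMeasure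

/-- The `N` world-lines started at `X`: `(worldLine X ω s) i = X i + √2 · (b_s(ω i k))_k ∈ ℝ³`, with
`b` the canonical Brownian motion. The factor `√2` makes the generator of each line the full
Laplacian `Δᵢ` (units `ħ = 2m = 1`, `H_N = -∑Δᵢ + …`), i.e. standard Brownian motion at speed `2`.
[cite: ChungZhao1995, §3.3 (3.34)] -/
def worldLine {N : ℕ} (X : Config N) (ω : PathSpace N) (s : ℝ≥0) : Config N :=
  fun i => X i + WithLp.toLp 2 (fun k => Real.sqrt 2 * brownian s (ω i k))

/-! ### The killed, weighted path measure and the Feynman–Kac functional -/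

/-- `e^{-a}` on `[0, ∞]`, with `e^{-∞} = 0` (an infinite action kills the path). [folklore] -/
def expNeg (a : ℝ≥0∞) : ℝ≥0∞ := if a = ∞ then 0 else ENNReal.ofReal (Real.exp (-a.toReal))

/-- The interaction action `∫₀ᵀ ∑_{i<j} v(|Bⁱ_s - Bʲ_s|) ds ∈ [0, ∞]` of the world-lines started at
`X` along the sample `ω` (lower Lebesgue integral over `s ∈ (0, T]`).
[cite: ChungZhao1995, §3.3 (3.34)] -/
def pathAction {N : ℕ} (v : ℝ → ℝ≥0∞) (T : ℝ) (X : Config N) (ω : PathSpace N) : ℝ≥0∞ :=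
  ∫⁻ s in Set.Ioc (0 : ℝ) T, interaction v (worldLine X ω s.toNNReal)

/-- Dirichlet survival event `{τ_{∂Λ^N} > T}`: every world-line stays in the open box `Λ_L` at all
times `s ∈ [0, T]` (time `0` included: from `X ∉ Λ_L^N` nothing survives).
[cite: ChungZhao1995, §3.3 (3.34)] -/
def survives {N : ℕ} (L T : ℝ) (X : Config N) : Set (PathSpace N) :=
  {ω | ∀ s ∈ Set.Icc (0 : ℝ) T, worldLine X ω s.toNNReal ∈ boxN N L}

/-- The Feynman–Kac weight `𝟙{τ > T} · exp(-∫₀ᵀ ∑_{i<j} v(|Bⁱ_s - Bʲ_s|) ds) ∈ [0, 1]` of a sample.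
[cite: ChungZhao1995, §3.3 (3.34)] -/
def fkWeight {N : ℕ} (v : ℝ → ℝ≥0∞) (L T : ℝ) (X : Config N) : PathSpace N → ℝ≥0∞ :=
  (survives L T X).indicator fun ω => expNeg (pathAction v T X ω)

/-- The **killed, interaction-weighted path measure** of `N` distinguishable world-lines on `[0, T]`
started at `X`: `𝟙{τ_{Λ^N} > T} exp(-∫₀ᵀ ∑_{i<j} v) dW_X`, a sub-probability measure on
`PathSpace N` (the `T = 0`-temperature, open-world-line Feynman–Kac measure; no permutations).
[cite: ChungZhao1995, §3.3 (3.34)] -/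
def fkPathMeasure {N : ℕ} (v : ℝ → ℝ≥0∞) (L T : ℝ) (X : Config N) : Measure (PathSpace N) :=
  (wienerPaths N).withDensity (fkWeight v L T X)

/-- The **Feynman–Kac functional** `E_X[exp(-∫₀ᵀ ∑_{i<j} v(|Bⁱ_s - Bʲ_s|) ds) g(B_T); τ_{Λ^N} > T]`
for `g : Λ^N → [0, ∞]`: the Dirichlet Schrödinger semigroup `(e^{-T H_N} g)(X)`,
`H_N = -∑Δᵢ + ∑_{i<j} v(|xᵢ-xⱼ|)` on `Λ_L^N`, evaluated path-wise (Chung–Zhao's `T_{2T}` with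
`q = -V/2`, generator `Δ/2 + q`, Thm 3.27). [cite: ChungZhao1995, §3.3 (3.34) and Thm 3.17] -/
def fkSemigroup {N : ℕ} (v : ℝ → ℝ≥0∞) (L T : ℝ) (g : Config N → ℝ≥0∞) (X : Config N) : ℝ≥0∞ :=
  ∫⁻ ω, fkWeight v L T X ω * g (worldLine X ω T.toNNReal) ∂(wienerPaths N)

/-- The partition function `Z_T(X) = E_X[exp(-∫₀ᵀ ∑_{i<j} v); τ > T]` of the `N` killed, weighted
world-lines on `[0, T]` started at `X` (total mass of `fkPathMeasure`; `= (e^{-TH_N} 1)(X)`).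
[cite: ChungZhao1995, §3.3 (3.34)] -/
def fkPartition {N : ℕ} (v : ℝ → ℝ≥0∞) (L T : ℝ) (X : Config N) : ℝ≥0∞ :=
  fkSemigroup v L T (fun _ => 1) X

/-! ### The ground state through Feynman–Kac -/

/-- **`Ψ₀` is the Dirichlet ground state of `H_N` on `Λ_L^N`, in Feynman–Kac form** (hypothesis
structure). `Ψ₀ : (ℝ³)^N → ℝ` is measurable, nonnegative, vanishes off the open box, is
permutation symmetric and `L²`-normalised; the variational ground-state energy
`E₀ = groundStateEnergy v N L` (infimum over the symmetric `C¹` Dirichlet core) is finite;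
`Ψ₀` is a pointwise eigenfunction of the Feynman–Kac semigroup, `e^{-TH_N}Ψ₀ = e^{-E₀T}Ψ₀`
(so `E₀ = inf σ(H_N)` is attained); and `Ψ₀` is the Feynman–Kac limit: for every measurable
`g ≥ 0` with `∫ g² < ∞` and every `X`, `e^{E₀T} E_X[e^{-∫₀ᵀ∑v} g(B_T); τ > T] → ⟨Ψ₀, g⟩ Ψ₀(X)` as
`T → ∞` (rank-one ground-state projection: nondegeneracy). Any two witnesses coincide
(`IsGroundStateFK.unique`). For bounded `v` a witness exists (`GroundStateFeynmanKac`); for hard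
cores existence includes nondegeneracy, which may fail (Reed–Simon IV Thm XIII.48(b)). `N` is
implicit in `Ψ₀`.
[cite: GlimmJaffeQP1987, §3.3 Thm 3.3.2 and §3.4 (3.4.2)] -/
structure IsGroundStateFK {N : ℕ} (v : ℝ → ℝ≥0∞) (L : ℝ) (Ψ₀ : Config N → ℝ) : Prop where
  /-- `Ψ₀` is Borel measurable. -/
  measurable : Measurable Ψ₀
  /-- `Ψ₀ ≥ 0` (the Perron–Frobenius choice of phase). -/
  nonneg : ∀ X, 0 ≤ Ψ₀ X
  /-- Dirichlet condition: `Ψ₀` vanishes off the open box `Λ_L^N`. -/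
  eq_zero : ∀ X, X ∉ boxN N L → Ψ₀ X = 0
  /-- Bose symmetry (automatic for the nondegenerate absolute ground state). -/
  symm : ∀ (σ : Equiv.Perm (Fin N)) (X : Config N), Ψ₀ (X ∘ σ) = Ψ₀ X
  /-- Normalisation `∫ Ψ₀² = 1`. -/
  norm_eq : ∫⁻ X, ENNReal.ofReal (Ψ₀ X) ^ 2 = 1
  /-- The variational ground-state energy is finite. -/
  energy_ne_top : groundStateEnergy v N L ≠ ⊤
  /-- Eigen-relation `(e^{-TH_N} Ψ₀)(X) = e^{-E₀ T} Ψ₀(X)` for all `T ≥ 0` and all `X`, with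
  `E₀ = groundStateEnergy v N L`. -/
  eigen : ∀ T : ℝ, 0 ≤ T → ∀ X : Config N,
    fkSemigroup v L T (fun Y => ENNReal.ofReal (Ψ₀ Y)) X =
      ENNReal.ofReal (Real.exp (-((groundStateEnergy v N L).toReal * T)) * Ψ₀ X)
  /-- Ground-state projection: `e^{E₀T} (e^{-TH_N} g)(X) → ⟨Ψ₀, g⟩ Ψ₀(X)` for `g ∈ L²₊` and all
  `X`. -/
  tendsto : ∀ g : Config N → ℝ≥0∞, Measurable g → ∫⁻ Y, g Y ^ 2 ≠ ⊤ → ∀ X : Config N,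
    Tendsto (fun T : ℝ => ENNReal.ofReal (Real.exp ((groundStateEnergy v N L).toReal * T)) *
      fkSemigroup v L T g X) atTop
      (𝓝 ((∫⁻ Y, ENNReal.ofReal (Ψ₀ Y) * g Y) * ENNReal.ofReal (Ψ₀ X)))

/-- **Ground-state Feynman–Kac theorem for bounded pair potentials** (named fact). For `N ≥ 1`
particles in the box `Λ_L`, `L > 0`, with a measurable BOUNDED repulsive radial pair potential
`v : ℝ → [0, ∞]`, the Dirichlet Hamiltonian `H_N = -∑Δᵢ + ∑_{i<j} v(|xᵢ-xⱼ|)` on `Λ_L^N` has a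
unique normalised nonnegative ground state `Ψ₀`; it is continuous, strictly positive on the open
box, permutation symmetric, its energy is the variational infimum `groundStateEnergy v N L`, and
it is the Feynman–Kac limit `e^{E₀T}(e^{-TH_N}g)(X) → ⟨Ψ₀,g⟩Ψ₀(X)` (`IsGroundStateFK`).
Assembly of: the Feynman–Kac semigroup of killed Brownian motion on the bounded regular domain
`Λ_L^N` with a bounded potential — self-adjoint, `L² → L^∞`, strong Feller, compact, continuous
strictly positive kernel, eigenfunctions in `C₀`, generator `Δ/2 + q` on `W₀^{1,2}`, variational
top of spectrum over `C_c^∞` (Chung–Zhao Thms 2.4, 3.17, 3.27, Prop 3.29); positivity improving ⇒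
simple strictly positive ground state (Reed–Simon IV Thm XIII.44; Glimm–Jaffe Thms 3.3.2–3.3.3),
hence Bose symmetric with symmetric infimum = `inf σ(H_N)` (Reed–Simon IV §XIII.12, remark after
Thm XIII.46);
spectral theorem ⇒ `e^{tE₀}e^{-tH}g → ⟨Ψ₀,g⟩Ψ₀` (Glimm–Jaffe (3.4.2)), pointwise via
`T_1 : L² → L^∞`.
[cite: ChungZhao1995, Thms 3.17 and 3.27 with Prop 3.29] -/
def GroundStateFeynmanKac : Prop :=
  ∀ (N : ℕ) (L : ℝ) (v : ℝ → ℝ≥0∞), 1 ≤ N → 0 < L → Measurable v → (∃ C : ℝ≥0, ∀ r, v r ≤ C) →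
    ∃ Ψ₀ : Config N → ℝ, IsGroundStateFK v L Ψ₀ ∧ Continuous Ψ₀ ∧ ∀ X ∈ boxN N L, 0 < Ψ₀ X

/-! ### Basic API -/

/-- `wienerPaths N` is a probability measure (finite product of probability measures). [folklore] -/
instance isProbabilityMeasure_wienerPaths (N : ℕ) : IsProbabilityMeasure (wienerPaths N) := by
  haveI := Literature.Probability.RandomPlanarGeometry.isProbabilityMeasure_preWienerMeasure'
  unfold wienerPaths
  infer_instance

/-- World-lines start at `X`: `B_0 = X` (`brownian 0 = 0`). [folklore] -/
@[simp] theorem worldLine_zero {N : ℕ} (X : Config N) (ω : PathSpace N) : worldLine X ω 0 = X := by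
  funext i
  simp only [worldLine, brownian_zero, Pi.zero_apply, mul_zero]
  rw [← Pi.zero_def, WithLp.toLp_zero, add_zero]

/-- Each time-marginal `ω ↦ B_s(ω)` of the world-lines is measurable. [folklore] -/
@[fun_prop]
theorem measurable_worldLine {N : ℕ} (X : Config N) (s : ℝ≥0) :
    Measurable fun ω : PathSpace N => worldLine X ω s := by
  refine measurable_pi_lambda _ fun i => ?_
  refine measurable_const.add ?_
  refine (WithLp.measurable_toLp 2 _).comp ?_
  refine measurable_pi_lambda _ fun k => ?_
  exact measurable_const.mul
    ((measurable_brownian s).comp ((measurable_pi_apply k).comp (measurable_pi_apply i)))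

/-- Every world-line is continuous in time. [folklore] -/
theorem continuous_worldLine {N : ℕ} (X : Config N) (ω : PathSpace N) :
    Continuous fun s => worldLine X ω s := by
  refine continuous_pi fun i => ?_
  refine continuous_const.add ?_
  exact (PiLp.continuous_toLp 2 _).comp
    (continuous_pi fun k => continuous_const.mul (continuous_brownian (ω i k)))

/-- `e^{-0} = 1`. [folklore] -/
@[simp] theorem expNeg_zero : expNeg 0 = 1 := by simp [expNeg]

/-- `e^{-∞} = 0`. [folklore] -/
@[simp] theorem expNeg_top : expNeg ∞ = 0 := by simp [expNeg]

/-- `e^{-a} ≤ 1`. [folklore] -/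
theorem expNeg_le_one (a : ℝ≥0∞) : expNeg a ≤ 1 := by
  unfold expNeg
  split_ifs with h
  · exact zero_le_one
  · exact ENNReal.ofReal_le_one.2 (Real.exp_le_one_iff.2 (neg_nonpos.2 ENNReal.toReal_nonneg))

/-- Multiplicativity `e^{-(a+b)} = e^{-a} e^{-b}` on `[0, ∞]` (the algebra behind the semigroup /
Markov property of the weights). [folklore] -/
theorem expNeg_add (a b : ℝ≥0∞) : expNeg (a + b) = expNeg a * expNeg b := by
  unfold expNeg
  rcases eq_or_ne a ∞ with rfl | ha
  · simp
  rcases eq_or_ne b ∞ with rfl | hb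
  · simp
  rw [if_neg (ENNReal.add_ne_top.2 ⟨ha, hb⟩), if_neg ha, if_neg hb, ENNReal.toReal_add ha hb,
    neg_add, Real.exp_add, ENNReal.ofReal_mul (Real.exp_pos _).le]

/-- The Feynman–Kac weight is at most `1`. [folklore] -/
theorem fkWeight_le_one {N : ℕ} (v : ℝ → ℝ≥0∞) (L T : ℝ) (X : Config N) (ω : PathSpace N) :
    fkWeight v L T X ω ≤ 1 := by
  unfold fkWeight
  refine (Set.indicator_le_self' (fun _ _ => bot_le) ω).trans ?_
  exact expNeg_le_one _

/-- The killed path measure is dominated by the Wiener measure (weights `≤ 1`); in particular it is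
a finite (sub-probability) measure. [folklore] -/
theorem fkPathMeasure_le {N : ℕ} (v : ℝ → ℝ≥0∞) (L T : ℝ) (X : Config N) :
    fkPathMeasure v L T X ≤ wienerPaths N := by
  calc fkPathMeasure v L T X
      ≤ (wienerPaths N).withDensity 1 :=
        withDensity_mono (Eventually.of_forall fun ω => fkWeight_le_one v L T X ω)
    _ = wienerPaths N := withDensity_one

/-- The total mass of the killed path measure is the partition function
`Z_T(X) = E_X[𝟙{τ > T} e^{-∫₀ᵀ∑v}]`. [folklore] -/
theorem fkPathMeasure_univ {N : ℕ} (v : ℝ → ℝ≥0∞) (L T : ℝ) (X : Config N) :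
    fkPathMeasure v L T X Set.univ = fkPartition v L T X := by
  rw [fkPathMeasure, withDensity_apply _ MeasurableSet.univ, Measure.restrict_univ]
  simp [fkPartition, fkSemigroup]

/-- The Feynman–Kac functional is bounded by `sup g` (sub-Markov property: weights `≤ 1`,
probability reference measure). [folklore] -/
theorem fkSemigroup_le_iSup {N : ℕ} (v : ℝ → ℝ≥0∞) (L T : ℝ) (g : Config N → ℝ≥0∞)
    (X : Config N) : fkSemigroup v L T g X ≤ ⨆ Y, g Y := by
  unfold fkSemigroup
  calc ∫⁻ ω, fkWeight v L T X ω * g (worldLine X ω T.toNNReal) ∂wienerPaths N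
      ≤ ∫⁻ _ω, ⨆ Y, g Y ∂wienerPaths N := lintegral_mono fun ω => by
        calc fkWeight v L T X ω * g (worldLine X ω T.toNNReal) ≤ 1 * ⨆ Y, g Y :=
              mul_le_mul' (fkWeight_le_one v L T X ω) (le_iSup g _)
          _ = ⨆ Y, g Y := one_mul _
    _ = ⨆ Y, g Y := by rw [lintegral_const, measure_univ, mul_one]

/-- The killed path measure is a sub-probability measure: `Z_T(X) ≤ 1`. [folklore] -/
theorem fkPartition_le_one {N : ℕ} (v : ℝ → ℝ≥0∞) (L T : ℝ) (X : Config N) :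
    fkPartition v L T X ≤ 1 :=
  (fkSemigroup_le_iSup v L T _ X).trans (by simp)

/-- The Feynman–Kac functional is monotone in the observable. [folklore] -/
theorem fkSemigroup_mono {N : ℕ} (v : ℝ → ℝ≥0∞) (L T : ℝ) {g g' : Config N → ℝ≥0∞} (h : g ≤ g')
    (X : Config N) : fkSemigroup v L T g X ≤ fkSemigroup v L T g' X :=
  lintegral_mono fun _ => mul_le_mul' le_rfl (h _)

/-- The functional only sees the observable on the open box: killed paths carry weight `0`, and a
surviving path sits in `Λ_L^N` at time `T`. [folklore] -/
theorem fkSemigroup_indicator {N : ℕ} (v : ℝ → ℝ≥0∞) (L : ℝ) {T : ℝ} (hT : 0 ≤ T)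
    (g : Config N → ℝ≥0∞) (X : Config N) :
    fkSemigroup v L T ((boxN N L).indicator g) X = fkSemigroup v L T g X := by
  refine lintegral_congr fun ω => ?_
  by_cases hω : ω ∈ survives L T X
  · rw [Set.indicator_of_mem (hω T ⟨hT, le_rfl⟩)]
  · simp [fkWeight, Set.indicator_of_notMem hω]

/-- In particular `Z_T(X) = (e^{-TH_N} 𝟙_{Λ^N})(X)`. [folklore] -/
theorem fkPartition_eq_fkSemigroup_indicator {N : ℕ} (v : ℝ → ℝ≥0∞) (L : ℝ) {T : ℝ} (hT : 0 ≤ T)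
    (X : Config N) : fkPartition v L T X = fkSemigroup v L T ((boxN N L).indicator 1) X := by
  rw [fkPartition, fkSemigroup_indicator v L hT]
  rfl

/-- Dirichlet killing at time `0`: from a starting point outside the open box nothing survives, the
Feynman–Kac weight vanishes identically. [folklore] -/
theorem fkWeight_of_notMem {N : ℕ} (v : ℝ → ℝ≥0∞) {L : ℝ} {T : ℝ} (hT : 0 ≤ T) {X : Config N}
    (hX : X ∉ boxN N L) : fkWeight v L T X = 0 := by
  funext ω
  refine Set.indicator_of_notMem (fun hω => hX ?_) _
  simpa using hω 0 ⟨le_rfl, hT⟩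

/-- Hence the killed path measure from `X ∉ Λ_L^N` is zero. [folklore] -/
theorem fkPathMeasure_of_notMem {N : ℕ} (v : ℝ → ℝ≥0∞) {L : ℝ} {T : ℝ} (hT : 0 ≤ T) {X : Config N}
    (hX : X ∉ boxN N L) : fkPathMeasure v L T X = 0 := by
  rw [fkPathMeasure, fkWeight_of_notMem v hT hX]
  exact withDensity_zero

/-- Hence `(e^{-TH_N} g)(X) = 0` for `X ∉ Λ_L^N`. [folklore] -/
theorem fkSemigroup_of_notMem {N : ℕ} (v : ℝ → ℝ≥0∞) {L : ℝ} {T : ℝ} (hT : 0 ≤ T)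
    (g : Config N → ℝ≥0∞) {X : Config N} (hX : X ∉ boxN N L) : fkSemigroup v L T g X = 0 := by
  simp [fkSemigroup, fkWeight_of_notMem v hT hX]

/-- At `T = 0` the weight is `1` when `X ∈ Λ_L^N` (empty action, `B_0 = X`). [folklore] -/
theorem fkWeight_zero_of_mem {N : ℕ} (v : ℝ → ℝ≥0∞) {L : ℝ} {X : Config N} (hX : X ∈ boxN N L) :
    fkWeight v L 0 X = 1 := by
  funext ω
  have hω : ω ∈ survives L 0 X := by
    intro s hs
    have : s = 0 := le_antisymm hs.2 hs.1
    simpa [this] using hX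
  simp [fkWeight, Set.indicator_of_mem hω, pathAction]

/-- `e^{-0·H_N} = 𝟙_{Λ^N}`: at `T = 0` the functional returns `g(X)` on the box and `0` off it.
[folklore] -/
theorem fkSemigroup_zero {N : ℕ} (v : ℝ → ℝ≥0∞) (L : ℝ) (g : Config N → ℝ≥0∞) (X : Config N) :
    fkSemigroup v L 0 g X = (boxN N L).indicator g X := by
  by_cases hX : X ∈ boxN N L
  · rw [Set.indicator_of_mem hX, fkSemigroup, fkWeight_zero_of_mem v hX]
    simp
  · rw [Set.indicator_of_notMem hX]
    exact fkSemigroup_of_notMem v le_rfl g hX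

/-! ### Measurability of the killing event, the action and the weights -/

/-- The box `Λ_L` is open. [folklore] -/
theorem isOpen_box (L : ℝ) : IsOpen (box L) := by
  have : box L = ⋂ k : Fin 3, (fun x : Space => x k) ⁻¹' Set.Ioo 0 L := by
    ext x; simp [box]
  rw [this]
  exact isOpen_iInter_of_finite fun k => isOpen_Ioo.preimage (by fun_prop)

/-- The `N`-particle box `Λ_L^N` is open. [folklore] -/
theorem isOpen_boxN (N : ℕ) (L : ℝ) : IsOpen (boxN N L) := by
  have : boxN N L = ⋂ i : Fin N, (fun X : Config N => X i) ⁻¹' box L := by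
    ext X; simp [boxN]
  rw [this]
  exact isOpen_iInter_of_finite fun i => (isOpen_box L).preimage (continuous_apply i)

/-- The world-lines read at real times, `s ↦ B_{s⁺}`, are continuous. [folklore] -/
theorem continuous_worldLine_toNNReal {N : ℕ} (X : Config N) (ω : PathSpace N) :
    Continuous fun s : ℝ => worldLine X ω s.toNNReal :=
  (continuous_worldLine X ω).comp continuous_real_toNNReal

/-- **Countable description of the survival event.** By path continuity and openness of the box,
the world-lines stay in `Λ_L^N` during `[0, T]` iff, for some `n`, at every RATIONAL time in
`[0, T]` they are at extended distance `≥ 1/n` from the complement. [folklore] -/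
theorem survives_eq_iUnion_iInter {N : ℕ} (L T : ℝ) (X : Config N) :
    survives L T X = ⋃ n : ℕ, ⋂ q : ℚ, {ω | (q : ℝ) ∈ Set.Icc 0 T →
      ((n : ℝ≥0∞)⁻¹ ≤ Metric.infEDist (worldLine X ω (q : ℝ).toNNReal) (boxN N L)ᶜ)} := by
  ext ω
  simp only [survives, Set.mem_setOf_eq, Set.mem_iUnion, Set.mem_iInter]
  set γ : ℝ → Config N := fun s => worldLine X ω s.toNNReal with hγ
  have hγc : Continuous γ := continuous_worldLine_toNNReal X ω
  constructor
  · intro h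
    -- the compact arc `γ([0,T])` is disjoint from the closed complement of the box
    have hK : IsCompact (γ '' Set.Icc 0 T) := isCompact_Icc.image hγc
    have hdisj : Disjoint (γ '' Set.Icc 0 T) (boxN N L)ᶜ := by
      refine Set.disjoint_left.2 ?_
      rintro _ ⟨s, hs, rfl⟩ hF
      exact hF (h s hs)
    obtain ⟨r, hr, hK'⟩ := Metric.exists_pos_forall_lt_edist hK (isOpen_boxN N L).isClosed_compl
      hdisj
    obtain ⟨n, hn⟩ := ENNReal.exists_inv_nat_lt (a := r) (by exact_mod_cast hr.ne')
    refine ⟨n, fun q hq => hn.le.trans ?_⟩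
    exact Metric.le_infEDist.2 fun y hy => (hK' _ ⟨q, hq, rfl⟩ y hy).le
  · rintro ⟨n, hn⟩ s hs
    -- the closed set `S = {s | 1/n ≤ infEDist (γ s) (Λ^N)ᶜ}` contains the rationals of `[0, T]`,
    -- hence all of `[0, T]`
    set S : Set ℝ := {s | (n : ℝ≥0∞)⁻¹ ≤ Metric.infEDist (γ s) (boxN N L)ᶜ} with hS
    have hSc : IsClosed S :=
      isClosed_le continuous_const (Metric.continuous_infEDist.comp hγc)
    have hrat : Set.Ioo 0 T ∩ Set.range ((↑) : ℚ → ℝ) ⊆ S := by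
      rintro _ ⟨hq, q, rfl⟩
      exact hn q (Set.Ioo_subset_Icc_self hq)
    have hIoo : Set.Ioo 0 T ⊆ S :=
      ((Rat.denseRange_cast.open_subset_closure_inter isOpen_Ioo).trans
        (closure_minimal hrat hSc))
    have hsS : s ∈ S := by
      rcases eq_or_lt_of_le hs.1 with h0 | h0
      · -- `s = 0` is rational
        have h00 := hn 0 (by simpa [← h0] using hs)
        show (n : ℝ≥0∞)⁻¹ ≤ Metric.infEDist (γ s) (boxN N L)ᶜ
        rw [← h0, hγ]
        simpa using h00
      · have hT : (0 : ℝ) ≠ T := (h0.trans_le hs.2).ne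
        have : s ∈ closure (Set.Ioo 0 T) := by
          rw [closure_Ioo hT]; exact hs
        exact closure_minimal hIoo hSc this
    -- positive distance from the complement: `γ s` is in the (open) box
    have hpos : 0 < Metric.infEDist (γ s) (boxN N L)ᶜ :=
      lt_of_lt_of_le (ENNReal.inv_pos.2 (ENNReal.natCast_ne_top n)) hsS
    have := (Metric.infEDist_pos_iff_notMem_closure.1 hpos)
    rw [(isOpen_boxN N L).isClosed_compl.closure_eq, Set.notMem_compl_iff] at this
    exact this

/-- The Dirichlet survival event is measurable. [folklore] -/
theorem measurableSet_survives {N : ℕ} (L T : ℝ) (X : Config N) :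
    MeasurableSet (survives L T X) := by
  rw [survives_eq_iUnion_iInter]
  refine MeasurableSet.iUnion fun n => MeasurableSet.iInter fun q => ?_
  by_cases hq : (q : ℝ) ∈ Set.Icc 0 T
  · simp only [hq, forall_const]
    exact measurableSet_le measurable_const
      (Metric.continuous_infEDist.measurable.comp (measurable_worldLine X _))
  · simp [hq]

/-- The world-lines are jointly measurable in (sample, real time). [folklore] -/
theorem measurable_worldLine_uncurry {N : ℕ} (X : Config N) :
    Measurable fun p : PathSpace N × ℝ => worldLine X p.1 p.2.toNNReal := by
  have h : Measurable (Function.uncurry fun (s : ℝ≥0) (ω : PathSpace N) => worldLine X ω s) :=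
    measurable_uncurry_of_continuous_of_measurable (continuous_worldLine X) (measurable_worldLine X)
  exact h.comp ((measurable_real_toNNReal.comp measurable_snd).prodMk measurable_fst)

/-- The interaction action `ω ↦ ∫₀ᵀ ∑_{i<j} v(|Bⁱ_s - Bʲ_s|) ds` is measurable (Tonelli), for
measurable `v`. [folklore] -/
theorem measurable_pathAction {N : ℕ} {v : ℝ → ℝ≥0∞} (hv : Measurable v) (T : ℝ)
    (X : Config N) : Measurable (pathAction v T X) :=
  ((measurable_interaction hv).comp (measurable_worldLine_uncurry X)).lintegral_prod_right'

/-- `expNeg` is measurable. [folklore] -/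
theorem measurable_expNeg : Measurable expNeg := by
  refine Measurable.ite (measurableSet_singleton _) measurable_const ?_
  exact ENNReal.measurable_ofReal.comp (Real.measurable_exp.comp ENNReal.measurable_toReal.neg)

/-- The Feynman–Kac weight is measurable (for measurable `v`). [folklore] -/
theorem measurable_fkWeight {N : ℕ} {v : ℝ → ℝ≥0∞} (hv : Measurable v) (L T : ℝ) (X : Config N) :
    Measurable (fkWeight v L T X) :=
  (measurable_expNeg.comp (measurable_pathAction hv T X)).indicator (measurableSet_survives L T X)

/-- **Integration against the killed path measure** is integration of `weight × integrand`
against the Wiener measure, for EVERY `[0, ∞]`-valued integrand (the weight is measurable and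
finite). [folklore] -/
theorem lintegral_fkPathMeasure {N : ℕ} {v : ℝ → ℝ≥0∞} (hv : Measurable v) (L T : ℝ)
    (X : Config N) (f : PathSpace N → ℝ≥0∞) :
    ∫⁻ ω, f ω ∂fkPathMeasure v L T X = ∫⁻ ω, fkWeight v L T X ω * f ω ∂wienerPaths N :=
  lintegral_withDensity_eq_lintegral_mul_non_measurable _ (measurable_fkWeight hv L T X)
    (Eventually.of_forall fun ω => (fkWeight_le_one v L T X ω).trans_lt ENNReal.one_lt_top) f

/-- The Feynman–Kac functional is the expectation of `g(B_T)` under the killed, weighted path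
measure: `(e^{-TH_N} g)(X) = ∫ g(B_T) d(fkPathMeasure)` (for measurable `v`; any `g`).
[cite: ChungZhao1995, §3.3 (3.34)] -/
theorem fkSemigroup_eq_lintegral_fkPathMeasure {N : ℕ} {v : ℝ → ℝ≥0∞} (hv : Measurable v)
    (L T : ℝ) (g : Config N → ℝ≥0∞) (X : Config N) :
    fkSemigroup v L T g X = ∫⁻ ω, g (worldLine X ω T.toNNReal) ∂fkPathMeasure v L T X := by
  rw [lintegral_fkPathMeasure hv]
  rfl

/-- The killed path measure is finite. [folklore] -/
instance isFiniteMeasure_fkPathMeasure {N : ℕ} (v : ℝ → ℝ≥0∞) (L T : ℝ) (X : Config N) :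
    IsFiniteMeasure (fkPathMeasure v L T X) :=
  isFiniteMeasure_of_le _ (fkPathMeasure_le v L T X)

/-! ### Consequences of `IsGroundStateFK` -/

namespace IsGroundStateFK

variable {N : ℕ} {v : ℝ → ℝ≥0∞} {L : ℝ} {Ψ₀ Φ : Config N → ℝ}

/-- A witness has finite (unit) `L²` mass `∫ (ofReal Ψ₀)² = 1 ≠ ⊤`. [folklore] -/
theorem lintegral_sq_ne_top (h : IsGroundStateFK v L Ψ₀) :
    ∫⁻ X, ENNReal.ofReal (Ψ₀ X) ^ 2 ≠ ⊤ := by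
  rw [h.norm_eq]; exact ENNReal.one_ne_top

/-- Along a second witness `Φ` the renormalised functional is constant:
`e^{E₀T} (e^{-TH_N} Φ)(X) = Φ(X)` for `T ≥ 0`. [folklore] -/
theorem ofReal_exp_mul_fkSemigroup (h : IsGroundStateFK v L Φ) {T : ℝ} (hT : 0 ≤ T) (X : Config N) :
    ENNReal.ofReal (Real.exp ((groundStateEnergy v N L).toReal * T)) *
        fkSemigroup v L T (fun Y => ENNReal.ofReal (Φ Y)) X = ENNReal.ofReal (Φ X) := by
  rw [h.eigen T hT X, ← ENNReal.ofReal_mul (Real.exp_pos _).le, ← mul_assoc, ← Real.exp_add,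
    add_neg_cancel, Real.exp_zero, one_mul]

/-- **Uniqueness of the Feynman–Kac ground state.** Two witnesses of `IsGroundStateFK v N L`
coincide (the projection limit of the first, tested on the second, which is an exact
eigenfunction, forces `Φ = ⟨Ψ₀, Φ⟩ Ψ₀`; normalisation gives `⟨Ψ₀, Φ⟩ = 1`). [folklore] -/
theorem unique (h₁ : IsGroundStateFK v L Ψ₀) (h₂ : IsGroundStateFK v L Φ) : Ψ₀ = Φ := by
  -- the overlap `c = ⟨Ψ₀, Φ⟩`
  set c : ℝ≥0∞ := ∫⁻ Y, ENNReal.ofReal (Ψ₀ Y) * ENNReal.ofReal (Φ Y) with hc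
  -- Step 1: `Φ = c • Ψ₀` pointwise (in `[0, ∞]`)
  have hpt : ∀ X, ENNReal.ofReal (Φ X) = c * ENNReal.ofReal (Ψ₀ X) := by
    intro X
    have hlim := h₁.tendsto (fun Y => ENNReal.ofReal (Φ Y)) h₂.measurable.ennreal_ofReal
      h₂.lintegral_sq_ne_top X
    have hconst : (fun T : ℝ => ENNReal.ofReal (Real.exp ((groundStateEnergy v N L).toReal * T)) *
        fkSemigroup v L T (fun Y => ENNReal.ofReal (Φ Y)) X) =ᶠ[atTop]
        fun _ => ENNReal.ofReal (Φ X) :=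
      (eventually_ge_atTop 0).mono fun T hT => h₂.ofReal_exp_mul_fkSemigroup hT X
    exact tendsto_nhds_unique (tendsto_const_nhds.congr' hconst.symm) hlim
  -- Step 2: `c ≠ ⊤` (`ab ≤ a² + b²`)
  have hc_top : c ≠ ⊤ := by
    refine ne_top_of_le_ne_top
      (ENNReal.add_ne_top.2 ⟨h₁.lintegral_sq_ne_top, h₂.lintegral_sq_ne_top⟩) ?_
    rw [← lintegral_add_left (h₁.measurable.ennreal_ofReal.pow_const 2)]
    refine lintegral_mono fun Y => ?_
    rcases le_total (ENNReal.ofReal (Ψ₀ Y)) (ENNReal.ofReal (Φ Y)) with hle | hle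
    · calc ENNReal.ofReal (Ψ₀ Y) * ENNReal.ofReal (Φ Y)
          ≤ ENNReal.ofReal (Φ Y) * ENNReal.ofReal (Φ Y) := mul_le_mul' hle le_rfl
        _ = ENNReal.ofReal (Φ Y) ^ 2 := (sq _).symm
        _ ≤ _ := le_add_self
    · calc ENNReal.ofReal (Ψ₀ Y) * ENNReal.ofReal (Φ Y)
          ≤ ENNReal.ofReal (Ψ₀ Y) * ENNReal.ofReal (Ψ₀ Y) := mul_le_mul' le_rfl hle
        _ = ENNReal.ofReal (Ψ₀ Y) ^ 2 := (sq _).symm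
        _ ≤ _ := le_self_add
  -- Step 3: `c = 1` from the normalisations
  have hc1 : c = 1 := by
    have h2 : c ^ 2 = 1 := by
      have := h₂.norm_eq
      simp_rw [hpt, mul_pow] at this
      rwa [lintegral_const_mul _ (h₁.measurable.ennreal_ofReal.pow_const 2), h₁.norm_eq,
        mul_one] at this
    have := (ENNReal.pow_right_strictMono two_ne_zero).injective (a₁ := c) (a₂ := 1)
    exact this (by simpa using h2)
  -- Step 4: conclude in `ℝ`
  funext X
  have := hpt X
  rw [hc1, one_mul] at this
  exact ((ENNReal.ofReal_eq_ofReal_iff (h₂.nonneg X) (h₁.nonneg X)).1 this).symm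

/-- **`Ψ₀` from the partition function of the future half-lines.** For a witness and `L` arbitrary:
`e^{E₀T} Z_T(X) → (∫ Ψ₀) · Ψ₀(X)` as `T → ∞`, for every `X`; i.e. `Ψ₀(x, Y)` is proportional to the
large-`T` partition function of `N` killed, weighted world-lines started at the slice `(x, Y)`
(the tagged line's future half-line given the bath). [folklore] -/
theorem tendsto_fkPartition (h : IsGroundStateFK v L Ψ₀) (X : Config N) :
    Tendsto (fun T : ℝ => ENNReal.ofReal (Real.exp ((groundStateEnergy v N L).toReal * T)) *
      fkPartition v L T X) atTop
      (𝓝 ((∫⁻ Y, ENNReal.ofReal (Ψ₀ Y)) * ENNReal.ofReal (Ψ₀ X))) := by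
  have hg : Measurable ((boxN N L).indicator (1 : Config N → ℝ≥0∞)) :=
    measurable_one.indicator (measurableSet_boxN N L)
  have hg2 : ∫⁻ Y, (boxN N L).indicator (1 : Config N → ℝ≥0∞) Y ^ 2 ≠ ⊤ := by
    have : (fun Y => (boxN N L).indicator (1 : Config N → ℝ≥0∞) Y ^ 2) =
        (boxN N L).indicator 1 := by
      funext Y; by_cases hY : Y ∈ boxN N L <;> simp [hY]
    rw [this, lintegral_indicator_one (measurableSet_boxN N L)]
    exact (volume_boxN_lt_top N L).ne
  have hlim := h.tendsto _ hg hg2 X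
  have hinner : ∫⁻ Y, ENNReal.ofReal (Ψ₀ Y) * (boxN N L).indicator (1 : Config N → ℝ≥0∞) Y =
      ∫⁻ Y, ENNReal.ofReal (Ψ₀ Y) := by
    refine lintegral_congr fun Y => ?_
    by_cases hY : Y ∈ boxN N L
    · simp [hY]
    · simp [hY, h.eq_zero Y hY]
  rw [hinner] at hlim
  refine hlim.congr' ?_
  filter_upwards [eventually_ge_atTop 0] with T hT
  rw [fkPartition_eq_fkSemigroup_indicator v L hT]

end IsGroundStateFK

/-! ### The canonical Feynman–Kac ground state as a term -/

/-- **The** Feynman–Kac ground state `Ψ₀ = fkGroundState v N L : (ℝ³)^N → ℝ` of `N` particles in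
`Λ_L` with pair potential `v`: the witness of `IsGroundStateFK v L` chosen by classical choice
when one exists (it is then unique, `IsGroundStateFK.unique`), so that e.g. the conditional
landscape `W_Y(x) = -log Ψ₀(x, Y)²` can be written as a term. **Junk value** `0` when no witness
exists (degenerate or absent ground state). [folklore] -/
def fkGroundState (v : ℝ → ℝ≥0∞) (N : ℕ) (L : ℝ) : Config N → ℝ :=
  open Classical in
  if h : ∃ Ψ₀ : Config N → ℝ, IsGroundStateFK v L Ψ₀ then h.choose else 0

/-- If a witness exists, `fkGroundState` is one. [folklore] -/
theorem isGroundStateFK_fkGroundState {v : ℝ → ℝ≥0∞} {N : ℕ} {L : ℝ}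
    (h : ∃ Ψ₀ : Config N → ℝ, IsGroundStateFK v L Ψ₀) :
    IsGroundStateFK v L (fkGroundState v N L) := by
  rw [fkGroundState, dif_pos h]
  exact h.choose_spec

/-- Without a witness, `fkGroundState` is the junk value `0`. [folklore] -/
theorem fkGroundState_of_not {v : ℝ → ℝ≥0∞} {N : ℕ} {L : ℝ}
    (h : ¬ ∃ Ψ₀ : Config N → ℝ, IsGroundStateFK v L Ψ₀) : fkGroundState v N L = 0 := by
  rw [fkGroundState, dif_neg h]

/-- Every witness IS the canonical one (uniqueness). [folklore] -/
theorem IsGroundStateFK.eq_fkGroundState {v : ℝ → ℝ≥0∞} {N : ℕ} {L : ℝ} {Ψ₀ : Config N → ℝ}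
    (h : IsGroundStateFK v L Ψ₀) : Ψ₀ = fkGroundState v N L :=
  h.unique (isGroundStateFK_fkGroundState ⟨Ψ₀, h⟩)

/-- `fkGroundState ≥ 0` (in both branches). [folklore] -/
theorem fkGroundState_nonneg (v : ℝ → ℝ≥0∞) (N : ℕ) (L : ℝ) (X : Config N) :
    0 ≤ fkGroundState v N L X := by
  by_cases h : ∃ Ψ₀ : Config N → ℝ, IsGroundStateFK v L Ψ₀
  · exact (isGroundStateFK_fkGroundState h).nonneg X
  · simp [fkGroundState_of_not h]

/-- Under the named fact, for bounded measurable `v`, `N ≥ 1`, `L > 0`: the canonical Feynman–Kac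
ground state is a witness, continuous, and strictly positive on the open box.
[cite: ChungZhao1995, Thms 3.17 and 3.27 with Prop 3.29] -/
theorem GroundStateFeynmanKac.fkGroundState (hGS : GroundStateFeynmanKac) {N : ℕ} {L : ℝ}
    {v : ℝ → ℝ≥0∞} (hN : 1 ≤ N) (hL : 0 < L) (hv : Measurable v) (hb : ∃ C : ℝ≥0, ∀ r, v r ≤ C) :
    IsGroundStateFK v L (fkGroundState v N L) ∧ Continuous (fkGroundState v N L) ∧
      ∀ X ∈ boxN N L, 0 < fkGroundState v N L X := by
  obtain ⟨Ψ₀, hΨ, hcont, hpos⟩ := hGS N L v hN hL hv hb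
  obtain rfl := hΨ.eq_fkGroundState
  exact ⟨hΨ, hcont, hpos⟩

end Literature.MathematicalPhysics.QuantumManyBody.BoseGas

end
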